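import Mathlib.RepresentationTheory.Basic
import Mathlib.LinearAlgebra.DFinsupp
import Mathlib.Algebra.BigOperators.Finprod
import HarnessLib

/-!
# FLOOR-0 P3 — generic equivariant-components algebra: an equivariant map into an independent sum of stable submodules
# splits uniquely into equivariant components

Cell hodgecm-mathlib (D-0151), FLOOR 0, crux item H413 = stmt-HodgeConjecture-24833; programme P3 «U3-mult», line `F0_U3CohMultOne`
(F0P3-plan (g0)), ENGINE-INTERFACES §6 items g1∕g2 (the ALGEBRA half; the analytic half — «the Hodge parts of the distinct discrete `Π`
form an independent family of `rightRep`-stable submodules» — is F0P3-p04's `H413SpectrumJunction`).  PROOF lane, pure Mathlib, theorems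
only; author A-p09 (g18); `--supports stmt-HodgeConjecture-24833 --as helper`.

Setting (any commutative ring `k`, any monoid `G`): `R : Representation k G X`, a family `N : ι → Submodule k X` which is INDEPENDENT
(`iSupIndep N`) and `R`-STABLE (`∀ i g x, x ∈ N i → R g x ∈ N i`), and a `k`-linear `ψ : W → X`, equivariant for `ρ : Representation k G W`
(`ψ (ρ g w) = R g (ψ w)`), with values in `⨆ i, N i`.

* `exists_components` (g1): there is a family `ψc : ι → (W →ₗ[k] X)` with `ψc i w ∈ N i`, `i ↦ ψc i w` finitely supported,
  `ψ w = ∑ᶠ i, ψc i w` for every `w`, and EACH `ψc i` EQUIVARIANT (uniqueness of the decomposition + stability of the `N i`);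
* `components_unique`: any two families with the first three properties coincide (independence; no equivariance needed);
* `apply_mem_of_components_eq_zero_off` (g2 (b)): if `ψc i = 0` for all `i ≠ i₀` then `ψ` takes values in `N i₀`;
* `exists_component_ne_zero` (g2 (c)): `ψ ≠ 0 ⇒ ∃ i, ψc i ≠ 0`; `eq_zero_iff_components_eq_zero`.

This is the many-summand version of the two-part split `rank_intertwiningMap_le_one_of_split` of `Lines/F0_U3CohMultOne.lean` §3 (there:
`A ⊔ B` with `Disjoint A B`).  Elementary linear algebra (Bourbaki, *Algèbre* II §1 n°8, Prop. 10: unique decomposition in a direct sum of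
submodules; equivariance of the projections of a `G`-stable direct decomposition, Curtis–Reiner (10.6)); Mathlib supplies
`iSupIndep.dfinsupp_lsum_injective` and `Submodule.iSup_eq_range_dfinsupp_lsum`.

HC_CM is proved only modulo the 7 printed citations until rung 0 closes; this file proves nothing about them.

## References
* [BourbakiAlgebreVIII2012] N. Bourbaki, *Algèbre*, Ch. VIII (2012) — §4 n°1 (isotypic ∕ direct decompositions and their projectors); cf. *Algèbre* II §1 n°8.
* [Lang2002] S. Lang, *Algebra*, GTM 211 — Ch. III §3 (direct sums; uniqueness of components), XVIII §1 (`k[G]`-modules).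
-/

set_option autoImplicit false
set_option linter.dupNamespace false

noncomputable section

open Function

namespace Summit.HodgeConjecture.HodgeConjecture.Cruxes.H413.F0P3EquivariantComponents

universe uk uG uX uW uι

variable {k : Type uk} [CommRing k] {G : Type uG} [Monoid G]
variable {X : Type uX} [AddCommGroup X] [Module k X] {W : Type uW} [AddCommGroup W] [Module k W]
variable {ι : Type uι}

/-! ## §0 The sum map `(Π₀ i, N i) → X` (plumbing) -/

/-- The canonical sum map `(f_i)_i ↦ Σ_i f_i` out of the finitely supported families is the finite sum `∑ᶠ i, f i`. [folklore] -/
private theorem lsum_subtype_apply_eq_finsum [DecidableEq ι] (N : ι → Submodule k X) (f : Π₀ i, N i) :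
    DFinsupp.lsum ℕ (fun i => (N i).subtype) f = ∑ᶠ i, (f i : X) := by
  classical
  rw [DFinsupp.lsum_apply_apply, DFinsupp.sumAddHom_apply]
  simp only [LinearMap.toAddMonoidHom_coe, Submodule.coe_subtype]
  rw [DFinsupp.sum, finsum_eq_sum_of_support_subset]
  intro i hi
  rw [Finset.mem_coe, DFinsupp.mem_support_iff]
  intro h0
  exact hi (show (f i : X) = 0 by rw [h0]; rfl)

/-- A finitely supported `N`-adapted family `x : ι → X` (`x i ∈ N i`) packaged as an element of `Π₀ i, N i`. [folklore] -/
private theorem exists_dfinsupp_of_finite [DecidableEq ι] (N : ι → Submodule k X) (x : ι → X) (hx : ∀ i, x i ∈ N i)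
    (hfin : (support x).Finite) : ∃ f : Π₀ i, N i, ∀ i, (f i : X) = x i := by
  classical
  refine ⟨DFinsupp.mk hfin.toFinset fun i => ⟨x i.1, hx i.1⟩, fun i => ?_⟩
  rw [DFinsupp.mk_apply]
  split_ifs with h
  · rfl
  · rw [Set.Finite.mem_toFinset, mem_support, not_not] at h
    rw [h]
    rfl

/-- **Uniqueness of components in an independent sum** (Bourbaki II §1 n°8): if `N` is independent and two finitely supported
`N`-adapted families have the same sum, they are equal. [cite: Lang2002, Ch. III §3] -/
theorem eq_of_finsum_eq_finsum (N : ι → Submodule k X) (hN : iSupIndep N) {x y : ι → X} (hx : ∀ i, x i ∈ N i)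
    (hy : ∀ i, y i ∈ N i) (hxfin : (support x).Finite) (hyfin : (support y).Finite) (h : ∑ᶠ i, x i = ∑ᶠ i, y i) :
    x = y := by
  classical
  obtain ⟨f, hf⟩ := exists_dfinsupp_of_finite N x hx hxfin
  obtain ⟨g, hg⟩ := exists_dfinsupp_of_finite N y hy hyfin
  have hfg : DFinsupp.lsum ℕ (fun i => (N i).subtype) f = DFinsupp.lsum ℕ (fun i => (N i).subtype) g := by
    rw [lsum_subtype_apply_eq_finsum, lsum_subtype_apply_eq_finsum]
    simp only [hf, hg, h]
  have hfg' : f = g := hN.dfinsupp_lsum_injective hfg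
  funext i
  rw [← hf, ← hg, hfg']

/-! ## §1 Existence of equivariant components (g1) -/

/-- **Equivariant components** (g1).  `N : ι → Submodule k X` independent and `R`-stable, `ψ : W → X` `k`-linear, `ρ`/`R`-equivariant,
with values in `⨆ i, N i`: there is a family of `k`-linear maps `ψc i : W → X` with values in `N i`, finitely supported in `i` at each
`w`, summing to `ψ`, and each `ψc i` is equivariant.  (Decompose `ψ w` along the independent family — a LINEAR operation, the inverse of
the injective sum map `Π₀ i, N i → ⨆ N i`; equivariance: `R g` permutes nothing and preserves each `N i`, so applying `R g` to the
decomposition of `ψ w` IS the decomposition of `R g (ψ w) = ψ (ρ g w)`, by uniqueness.) [cite: Lang2002, Ch. III §3, XVIII §1]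
[cite: BourbakiAlgebreVIII2012, VIII §4 n°1] -/
theorem exists_components (R : Representation k G X) (N : ι → Submodule k X) (hN : iSupIndep N)
    (hNst : ∀ (i : ι) (g : G) (x : X), x ∈ N i → R g x ∈ N i)
    (ρ : Representation k G W) (ψ : W →ₗ[k] X) (hψ : ∀ (g : G) (w : W), ψ (ρ g w) = R g (ψ w))
    (hψN : ∀ w, ψ w ∈ ⨆ i, N i) :
    ∃ ψc : ι → (W →ₗ[k] X),
      (∀ i w, ψc i w ∈ N i) ∧ (∀ w, (support fun i => ψc i w).Finite) ∧ (∀ w, ψ w = ∑ᶠ i, ψc i w) ∧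
        ∀ (i : ι) (g : G) (w : W), ψc i (ρ g w) = R g (ψc i w) := by
  classical
  -- the sum map `L : (Π₀ i, N i) → X`, injective (independence) with range `⨆ N i`
  let L : (Π₀ i, N i) →ₗ[k] X := DFinsupp.lsum ℕ fun i => (N i).subtype
  have hLinj : Function.Injective L := hN.dfinsupp_lsum_injective
  have hLrange : LinearMap.range L = ⨆ i, N i := (Submodule.iSup_eq_range_dfinsupp_lsum N).symm
  -- its linear inverse on `⨆ N i`
  let e : (Π₀ i, N i) ≃ₗ[k] ↥(LinearMap.range L) := LinearEquiv.ofInjective L hLinj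
  let dec : ↥(⨆ i, N i) →ₗ[k] (Π₀ i, N i) :=
    e.symm.toLinearMap ∘ₗ (LinearEquiv.ofEq _ _ hLrange.symm).toLinearMap
  have hdec : ∀ s : ↥(⨆ i, N i), L (dec s) = s := by
    intro s
    have h1 : (e (dec s) : X) = L (dec s) := rfl
    rw [← h1]
    change ((e (e.symm (LinearEquiv.ofEq _ _ hLrange.symm s))) : X) = s
    rw [LinearEquiv.apply_symm_apply]
    rfl
  have hdec' : ∀ (s : ↥(⨆ i, N i)) (f : Π₀ i, N i), L f = s → dec s = f := by
    intro s f hf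
    exact hLinj ((hdec s).trans hf.symm)
  -- the components
  let ψS : W →ₗ[k] ↥(⨆ i, N i) := ψ.codRestrict _ hψN
  let ψc : ι → (W →ₗ[k] X) := fun i => (N i).subtype ∘ₗ DFinsupp.lapply i ∘ₗ dec ∘ₗ ψS
  have hψc : ∀ i w, ψc i w = ((dec (ψS w)) i : X) := fun i w => rfl
  refine ⟨ψc, fun i w => by rw [hψc]; exact ((dec (ψS w)) i).2, fun w => ?_, fun w => ?_, fun i g w => ?_⟩
  · -- finite support
    refine ((dec (ψS w)).support.finite_toSet).subset fun i hi => ?_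
    rw [Finset.mem_coe, DFinsupp.mem_support_iff]
    intro h0
    exact hi (show ψc i w = 0 by rw [hψc, h0]; rfl)
  · -- the sum is `ψ w`
    have h := hdec (ψS w)
    rw [lsum_subtype_apply_eq_finsum] at h
    exact h.symm
  · -- equivariance: transport the decomposition of `ψ w` by `R g`
    let f : Π₀ i, N i := dec (ψS w)
    let fg : Π₀ i, N i :=
      f.mapRange (fun i (x : ↥(N i)) => (⟨R g (x : X), hNst i g (x : X) x.2⟩ : ↥(N i))) fun i => by ext; simp
    have hfg : ∀ i, (fg i : X) = R g (f i : X) := fun i => by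
      simp only [fg, DFinsupp.mapRange_apply]
    have hsupp : (support fun i => (f i : X)).Finite := by
      refine (f.support.finite_toSet).subset fun i hi => ?_
      rw [Finset.mem_coe, DFinsupp.mem_support_iff]
      intro h0
      exact hi (show (f i : X) = 0 by rw [h0]; rfl)
    have hLfg : L fg = R g (ψ w) := by
      rw [lsum_subtype_apply_eq_finsum]
      simp only [hfg]
      rw [← map_finsum (R g) hsupp]
      have h := hdec (ψS w)
      rw [lsum_subtype_apply_eq_finsum] at h
      rw [h]
      rfl
    have key : dec (ψS (ρ g w)) = fg := by
      refine hdec' _ fg ?_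
      rw [hLfg]
      exact (hψ g w).symm
    rw [hψc, key, hfg, hψc]

/-- **Uniqueness of the components**: two families of `N`-adapted, pointwise finitely supported linear maps summing to the same `ψ`
are equal (independence of `N`; equivariance plays no role). [cite: Lang2002, Ch. III §3] -/
theorem components_unique (N : ι → Submodule k X) (hN : iSupIndep N) {ψ : W →ₗ[k] X} {ψc ψc' : ι → (W →ₗ[k] X)}
    (h₁ : ∀ i w, ψc i w ∈ N i) (h₂ : ∀ w, (support fun i => ψc i w).Finite) (h₃ : ∀ w, ψ w = ∑ᶠ i, ψc i w)
    (h₁' : ∀ i w, ψc' i w ∈ N i) (h₂' : ∀ w, (support fun i => ψc' i w).Finite) (h₃' : ∀ w, ψ w = ∑ᶠ i, ψc' i w) :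
    ψc = ψc' := by
  funext i
  refine LinearMap.ext fun w => ?_
  have h := eq_of_finsum_eq_finsum N hN (fun j => h₁ j w) (fun j => h₁' j w) (h₂ w) (h₂' w) ((h₃ w).symm.trans (h₃' w))
  exact congrFun h i

/-! ## §2 Reading a decomposition (g2) -/

/-- **(g2 b) One live component ⇒ values in that part**: if all components off `i₀` vanish, `ψ` takes values in `N i₀`.
[cite: Lang2002, Ch. III §3] -/
theorem apply_mem_of_components_eq_zero_off (N : ι → Submodule k X) {ψ : W →ₗ[k] X} {ψc : ι → (W →ₗ[k] X)}
    (h₁ : ∀ i w, ψc i w ∈ N i) (h₃ : ∀ w, ψ w = ∑ᶠ i, ψc i w) (i₀ : ι) (hoff : ∀ i, i ≠ i₀ → ψc i = 0) (w : W) :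
    ψ w ∈ N i₀ := by
  rw [h₃ w, finsum_eq_single (fun i => ψc i w) i₀ fun i hi => by rw [hoff i hi, LinearMap.zero_apply]]
  exact h₁ i₀ w

/-- **(g2 c) A non-zero map has a non-zero component.** [cite: Lang2002, Ch. III §3] -/
theorem exists_component_ne_zero {ψ : W →ₗ[k] X} {ψc : ι → (W →ₗ[k] X)} (h₃ : ∀ w, ψ w = ∑ᶠ i, ψc i w)
    (hψ : ψ ≠ 0) : ∃ i, ψc i ≠ 0 := by
  by_contra h
  have h' : ∀ i, ψc i = 0 := fun i => by_contra fun hi => h ⟨i, hi⟩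
  apply hψ
  refine LinearMap.ext fun w => ?_
  rw [h₃ w, LinearMap.zero_apply]
  simp [h']

/-- `ψ = 0` iff all its components vanish. [cite: Lang2002, Ch. III §3] -/
theorem eq_zero_iff_components_eq_zero (N : ι → Submodule k X) (hN : iSupIndep N) {ψ : W →ₗ[k] X} {ψc : ι → (W →ₗ[k] X)}
    (h₁ : ∀ i w, ψc i w ∈ N i) (h₂ : ∀ w, (support fun i => ψc i w).Finite) (h₃ : ∀ w, ψ w = ∑ᶠ i, ψc i w) :
    ψ = 0 ↔ ∀ i, ψc i = 0 := by
  refine ⟨fun hψ => ?_, fun h => ?_⟩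
  · -- the zero family also decomposes `ψ = 0`; uniqueness
    have hz : ψc = fun _ => 0 :=
      components_unique N hN h₁ h₂ h₃ (fun i w => by rw [LinearMap.zero_apply]; exact (N i).zero_mem)
        (fun w => Set.finite_empty.subset fun i hi => (hi rfl).elim)
        (fun w => by rw [hψ, LinearMap.zero_apply]; simp)
    intro i
    rw [hz]
  · by_contra hψ
    obtain ⟨i, hi⟩ := exists_component_ne_zero h₃ hψ
    exact hi (h i)

/-- **(g2 b′) Converse reading**: if `ψ` takes values in `N i₀` then its components are `ψ` at `i₀` and `0` elsewhere (uniqueness).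
[cite: Lang2002, Ch. III §3] -/
theorem components_eq_of_apply_mem [DecidableEq ι] (N : ι → Submodule k X) (hN : iSupIndep N) {ψ : W →ₗ[k] X}
    {ψc : ι → (W →ₗ[k] X)} (h₁ : ∀ i w, ψc i w ∈ N i) (h₂ : ∀ w, (support fun i => ψc i w).Finite)
    (h₃ : ∀ w, ψ w = ∑ᶠ i, ψc i w) (i₀ : ι) (hψ : ∀ w, ψ w ∈ N i₀) :
    ψc = fun i => if i = i₀ then ψ else 0 := by
  refine components_unique N hN h₁ h₂ h₃ (fun i w => ?_) (fun w => ?_) (fun w => ?_)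
  · by_cases hi : i = i₀
    · subst hi
      rw [if_pos rfl]
      exact hψ w
    · rw [if_neg hi, LinearMap.zero_apply]
      exact (N i).zero_mem
  · refine (Set.finite_singleton i₀).subset fun i hi => ?_
    rw [Set.mem_singleton_iff]
    by_contra hne
    exact hi (show (if i = i₀ then ψ else (0 : W →ₗ[k] X)) w = 0 by rw [if_neg hne, LinearMap.zero_apply])
  · rw [finsum_eq_single (fun i => (if i = i₀ then ψ else (0 : W →ₗ[k] X)) w) i₀ fun i hi =>
      show (if i = i₀ then ψ else (0 : W →ₗ[k] X)) w = 0 by rw [if_neg hi, LinearMap.zero_apply]]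
    simp only [if_true]

end Summit.HodgeConjecture.HodgeConjecture.Cruxes.H413.F0P3EquivariantComponents

end
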